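import Literature.AlgebraicGeometry.Deformation.T1Lifting
import Mathlib.Algebra.CharP.Basic
import Mathlib.RingTheory.Kaehler.Basic
import Mathlib.LinearAlgebra.Basis.Basic
import HarnessLib

/-!
# Deligne's example: the T¹-lifting theorem needs characteristic zero ([Sch03, Ex. 3.5 and Introduction];
# [Kaw92] as reported there) — with the converse (T¹-lifting for `h_{k[t]/(t^{n+1})}` iff `n = 0` or `p ∣ n + 1`)
# and «`Ω¹ ⊗ k` is free of rank one, generated by `dT`»

Family `hodge` (computation cell `pub-hsemireg`, LIT-W seat «Kawamata ∕ Ran T¹-lifting as printed»), layer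
`Literature/AlgebraicGeometry/Deformation`, on top of `T1Lifting.lean` (the test algebras `A_n = k[t]/(t^{n+1})`,
`B_n = A_n[ε] = k[x, y]/(x^{n+1}, y²)`, the maps `i : A_{n+1} → A_n`, `bA : B_n → A_n`, `β : B_{n+1} → B_n`, functors of Artin
rings `ArtinFunctor k`, the T¹-lifting property `ArtinFunctor.T1Lifting` of [FantechiManetti1999T1Lifting, Def. 1.1] and the
T¹-lifting theorem `ArtinFunctor.map_i_succ_surjective_of_t1Lifting` — for `char k = 0`, (H₄) and T¹-lifting:
`F(A_{m+2}) → F(A_{m+1})` onto for every `m`; also `fB : A_{m+1} → B_m`, `t ↦ x + y`, print's «`(T+ε)`») and Mathlib's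
Kähler differentials `Ω[S⁄R]` (`KaehlerDifferential.D`, `Derivation.liftKaehlerDifferential`, `Module.Basis`).
THEOREMS only (no definition, no named fact, no `sorry`).

## Sources, verbatim

* [Schroeer2003T1LiftingPositiveCharacteristic] (S. Schröer, «The T¹-lifting theorem in positive characteristic»,
  J. Algebraic Geom. 12 (2003) 699–714 = arXiv:math/0102203; store text `paper:arxiv-math_0102203`, arXiv chunk numbering —
  journal pages of the passages unseen), Introduction (chunk p0003 L13–25): «Generalizing Ran's work [Ran 1992], Kawamata
  [Kawamata 1992] proved a general result for functors of Artin `ℂ`-algebras called the `T¹`-lifting Theorem, and then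
  deduced the result on Calabi–Yau manifolds using Deligne's theorem on cohomological flatness of Kähler differentials
  [Deligne 1968]. The proofs for these results work in characteristic zero only. The reason is particularly visible in
  Kawamata's approach: At some point in the proof he needs invertibility of the binomial coefficient `\binom{n}{1}` in the
  binomial expansion of `(T+ε)^n`. This seems to lie at the heart of the matter.» (the arXiv v2 PDF prints the numeric
  marks «[20]», «[14]», «[3]» for «[Ran 1992]», «[Kawamata 1992]», «[Deligne 1968]» — the store text expands the cite keys;
  content-identical per the reference list, read by eye by lit-3 g62, cell bus l.26659 ∕ l.26822; the journal pages are
  unseen by the cell, presumably identical); EXAMPLE 3.5 (chunk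
  p0009 L36–52, whole first paragraph and the first two sentences of the second): «Consider the functor of Artin
  `W`-algebras `A ↦ {a ∈ A | a^p = 0}` represented by `R = W[T]/(T^p)`, and let `π : 𝒢 → (Art/W)` be the corresponding
  semihomogeneous cofibered groupoid. Clearly, `R` is not a smooth formal `W`-algebra. However, note that
  `Ω¹_{R/W} ⊗ k` is a free `R ⊗ k`-module of rank one, generated by `dT`. The restriction of `π : 𝒢 → (Art/W)` to
  formal Artin `k`-algebras is Deligne's example discussed in [Kawamata 1992], p. 158: It satisfies the `T¹`-lifting
  condition in Kawamata's sense without being smooth. Let me check that `𝒢` also does not satisfy the `T¹`-lifting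
  condition in our sense.» (that check — over `W_{m,d}`, with divided powers — is NOT typed here; `W` = a complete
  discrete valuation ring of mixed characteristic `(0, p)` with `e < p`, p0006 L14–24.)
  ([Kawamata 1992] = [Kawamata1992UnobstructedDeformations], J. Algebraic Geom. 1 (1992) 183–190 — NOT held by the cell;
  Schröer's «p. 158» does not match that pagination and is quoted as printed.)
* [FantechiManetti1999T1Lifting] (authors' version), Def. 1.1 (the T¹-lifting property: «for every `n ∈ ℕ`, the natural map
  `F(B_{n+1}) → F(B_n) ×_{F(A_n)} F(A_{n+1})` is surjective») and THEOREM A («Let `F` be a deformation functor. If `F`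
  satisfies the T¹-lifting property then it is smooth», `k` of characteristic `0` throughout that paper); p. 3 l. 21–25:
  «The cartesian diagram (in characteristic zero) [`A_{m+1} ≅ B_m ×_{C_m} A_m`, `f(t) = x + y`] …».

## What this file proves

For a field `k` and `n ∈ ℕ`, let `R_n = A_n = k[t]/(t^{n+1})` and `F_n = h_{R_n}` its functor of points
(`ArtinFunctor.points (A k n)`), i.e. print's functor «`A ↦ {a ∈ A | a^{n+1} = 0}`» (`DeligneExample.exists_point_iff`,
`DeligneExample.point_eq_of_apply_t_eq`: a point `R_n → S` is the same as an element `s ∈ S` with `s^{n+1} = 0`).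

* `DeligneExample.points_map_i_not_surjective` — «`R` is not smooth», concretely and in EVERY characteristic: for
  `n ≥ 1` the map `F_n(A_{n+1}) → F_n(A_n)` is NOT onto — the tautological point `t ↦ t` of `F_n(A_n)` does not lift
  (a lift is `t + c·t^{n+1} ∈ A_{n+1}`, whose `(n+1)`-st power is `t^{n+1} ≠ 0`).
* `DeligneExample.t1Lifting_points` — «it satisfies the `T¹`-lifting condition»: if `n + 1 = 0` in `k` (i.e.
  `char k ∣ n + 1`), then `F_n` HAS the T¹-lifting property of [FantechiManetti1999T1Lifting, Def. 1.1] (which implies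
  Kawamata's per-`X_n` form): a compatible pair (`u ∈ B_N` with `u^{n+1} = 0`, `v ∈ A_{N+1}` with `v^{n+1} = 0`,
  `u_x = v mod t^{N+1}`) lifts to `w = v + s·y ∈ B_{N+1}` (`s` any lift of `u_y`), because
  `(v + s y)^{n+1} = v^{n+1} + (n+1) vⁿ s y = 0` — exactly the binomial coefficient `\binom{n+1}{1}` of the printed
  diagnosis (`DeligneExample.add_pow_succ_of_mul_self_eq_zero`).
* `DeligneExample.t1Lifting_theorem_fails_of_charP` — THE PRINTED SENTENCE as a kernel statement: if `char k = p > 0`,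
  the functor `F = h_{k[t]/(t^p)}` («`A ↦ {a ∈ A | a^p = 0}`») satisfies (H₄) (tree: every functor of points does,
  `ArtinFunctor.points_H4`) AND the T¹-lifting property, and yet `F(A_p) → F(A_{p−1})` is not surjective — so the
  conclusion of the tree's characteristic-zero T¹-lifting theorem `ArtinFunctor.map_i_succ_surjective_of_t1Lifting`
  («`F(A_{m+2}) → F(A_{m+1})` onto for every `m`», here `m = p − 2`) FAILS for it: the hypothesis `CharZero k` of that
  theorem (print's «in characteristic zero», [FantechiManetti1999T1Lifting, p. 3]) cannot be dropped.
* §5, THE CONVERSE (a kernel sharpening of print's diagnosis «he needs invertibility of the binomial coefficient» — the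
  coefficient is the WHOLE obstruction): `DeligneExample.not_t1Lifting_points` — if `m + 2 ≠ 0` in `k` then `F_{m+1}`
  FAILS the T¹-lifting property, witnessed at level `N = m` by the compatible pair (`t ↦ x + y ∈ F_{m+1}(B_m)` — the
  tree's `fB_m`, print's «`(T+ε)`» — and `id ∈ F_{m+1}(A_{m+1})`): a common lift is `t ↦ x + s·y` with
  `s ≡ 1 (mod t^{m+1})` and `(x + s y)^{m+2} = (m+2)·x^{m+1}·y ≠ 0` (`DeligneExample.inl_t_add_inr_pow`). Hence
  `DeligneExample.t1Lifting_points_iff` — for ANY field `k` and `n ∈ ℕ`: `F_n` has the T¹-lifting property iff `n = 0`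
  or `n + 1 = 0` in `k`; and `not_t1Lifting_points_of_charZero` ∕ `…'` — in characteristic `0` never for `n ≥ 1` (the
  primed version independently, from the tree's T¹-lifting theorem and `points_map_i_not_surjective`).
* §6, «`Ω¹_{R/W} ⊗ k` is a free `R ⊗ k`-module of rank one, generated by `dT`», typed for `R ⊗_W k = k[t]/(t^{n+1}) = A_n`
  over `k`: `DeligneExample.exists_eq_smul_D_t` (`Ω_{A_n/k}` is generated by `dt`, any `n`, any `k`: `d(q(t)) = q′(t) dt`,
  `kaehlerDifferential_D_mk`); `natCast_succ_smul_t_pow_smul_D_t` (`(n+1)·tⁿ·dt = d(t^{n+1}) = 0`);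
  `exists_derivation_apply_t_eq_one` (if `n + 1 = 0` in `k`: the `k`-derivation `∂/∂t : A_n → A_n`, `t ↦ 1`, read off
  the point `t ↦ x + y ∈ F_n(B_n) = F_n(A_n[ε])`, which exists exactly then); **`exists_basis_kaehlerDifferential`** — if
  `n + 1 = 0` in `k`, `Ω_{A_n/k}` has an `A_n`-basis consisting of `dt` alone (so `Module.Free` of `finrank 1`,
  `free_and_finrank_kaehlerDifferential_eq_one`); the contrast `not_exists_basis_kaehlerDifferential` — if `n + 1 ≠ 0`
  in `k`, `dt` is torsion (`tⁿ dt = 0 ≠ tⁿ`) and no such basis exists; `charP_summary` — for `char k = p`, `n = p − 1`: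
  basis `{dT}` ∧ T¹-lifting ∧ `F(A_p) → F(A_{p−1})` not onto, the three printed assertions about `R ⊗ k = k[T]/(T^p)`.

HONEST SCOPE. (1) Print's object is a cofibered GROUPOID over Artin `W`-algebras (`W` of mixed characteristic) and its
restriction to Artin `k`-algebras; typed here is that restriction as the FUNCTOR of points of `k[t]/(t^p)` on the tree's
`Art_k` (no groupoid, no `W`, no divided powers — Schröer's own positive result, Thm. 3.4, and the second half of Ex. 3.5
(failure of HIS T¹-lifting condition over `W_{m,d}`, the divided-power test algebras of p0006) are NOT typed); print's
`Ω¹_{R/W} ⊗_W k` is typed as `Ω_{(R ⊗_W k)/k} = Ω_{A_{p−1}/k}` — the base-change identification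
`Ω_{R/W} ⊗_W k ≅ Ω_{(R ⊗_W k)/k}` ([Mat86, Thm. 25.1 ff.]; Mathlib `KaehlerDifferential.tensorKaehlerEquiv`) and
`R ⊗_W k = k[T]/(T^p)` are read, not re-derived, since `W` is not typed. (2) «without being smooth» is typed as the failure
of ONE surjectivity `F(A_p) → F(A_{p−1})` (enough to contradict the theorem's conclusion and [FantechiManetti1998ObstructionCalculus,
Def. 2.15]'s smoothness, `A_p → A_{p−1}` being a small extension — `T1Lifting.isSmallExtension_i`); no general
«smooth ⇔ power series ring» statement is used. (3) «in Kawamata's sense»: typed is the [FantechiManetti1999T1Lifting,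
Def. 1.1] form, which is Kawamata's relative form `T¹(X_{N+1}/A_{N+1}) → T¹(X_N/A_N)` onto for every `X_{N+1}`
([Tz10, Rem. 6.8]: the unmarked `T¹_D`); for a functor of points (no automorphisms) the marked and unmarked `T¹`
agree — not re-derived. (4) [Kawamata1992UnobstructedDeformations] itself is not held; the attribution «Deligne's
example» is Schröer's. (5) §5's converse and §6's torsion contrast are NOT sentences of print: they are the reader's
kernel verification that print's binomial coefficient `\binom{n+1}{1} = n + 1` is the exact obstruction, both to
T¹-lifting and to the freeness of `Ω¹` on `dT` (`d(T^{n+1}) = (n+1)Tⁿ dT`). Nothing here bears on HC ∕ HC_CM ∕ HC_AV, and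
no functor of any cell object is asserted to have or to lack any lifting property.

## References

* S. Schröer, *The T¹-lifting theorem in positive characteristic*, J. Algebraic Geom. 12 (2003) 699–714
  (arXiv:math/0102203): Introduction; Example 3.5. [Schroeer2003T1LiftingPositiveCharacteristic]
* B. Fantechi, M. Manetti, *On the T¹-lifting theorem*, J. Algebraic Geom. 8 (1999) 31–39: Def. 1.1, Thm. A, p. 3.
  [FantechiManetti1999T1Lifting]
* Y. Kawamata, *Unobstructed deformations — a remark on a paper of Z. Ran*, J. Algebraic Geom. 1 (1992) 183–190 (cited
  through Schröer; not held). [Kawamata1992UnobstructedDeformations]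
* H. Matsumura, *Commutative Ring Theory*, Cambridge Stud. Adv. Math. 8, CUP 1986 (bib year 1987): §25 (Kähler differentials, base
  change; first fundamental exact sequence). [Matsumura1987]
-/

noncomputable section

universe u

namespace Literature.AlgebraicGeometry.Deformation

open Polynomial TrivSqZeroExt T1Lifting

variable (k : Type u) [Field k]

namespace DeligneExample

/-! ### §0 The binomial coefficient `\binom{n+1}{1}`: `(x + y)^{n+1} = x^{n+1} + (n + 1) xⁿ y` when `y² = 0` -/

/-- «he needs invertibility of the binomial coefficient `\binom{n}{1}` in the binomial expansion of `(T+ε)^n`»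
([Schroeer2003T1LiftingPositiveCharacteristic, Introduction]): in any commutative ring, if `y² = 0` then
`(x + y)^{m+1} = x^{m+1} + (m + 1)·xᵐ·y`. [cite: Schroeer2003T1LiftingPositiveCharacteristic, Introduction (arXiv p0003 L19–23)] -/
theorem add_pow_succ_of_mul_self_eq_zero {R : Type u} [CommRing R] (x y : R) (hy : y * y = 0) (m : ℕ) :
    (x + y) ^ (m + 1) = x ^ (m + 1) + ((m : R) + 1) * x ^ m * y := by
  induction m with
  | zero => simp
  | succ m ih =>
      rw [pow_succ, ih]
      push_cast
      linear_combination (((m : R) + 1) * x ^ m) * hy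

/-! ### §1 The functor «`A ↦ {a ∈ A | a^{n+1} = 0}`» is `h_{k[t]/(t^{n+1})}` -/

variable {k}

/-- A point of `h_{A_n}(S)`, `A_n = k[t]/(t^{n+1})`, is determined by the image of `t`.
[cite: Schroeer2003T1LiftingPositiveCharacteristic, Ex. 3.5] -/
theorem point_eq_of_apply_t_eq {n : ℕ} {S : Type u} [CommRing S] [Algebra k S] {φ ψ : A k n →ₐ[k] S}
    (h : φ (t k n) = ψ (t k n)) : φ = ψ :=
  AdjoinRoot.algHom_ext h

/-- The image of `t` under a point of `h_{A_n}(S)` is killed by the `(n+1)`-st power.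
[cite: Schroeer2003T1LiftingPositiveCharacteristic, Ex. 3.5] -/
theorem apply_t_pow_succ {n : ℕ} {S : Type u} [CommRing S] [Algebra k S] (φ : A k n →ₐ[k] S) :
    φ (t k n) ^ (n + 1) = 0 := by
  rw [← map_pow, t_pow_succ, map_zero]

/-- **«the functor `A ↦ {a ∈ A | a^p = 0}` represented by `R = k[T]/(T^p)`»**
([Schroeer2003T1LiftingPositiveCharacteristic, Ex. 3.5], over `k`): for every commutative `k`-algebra `S` and `s ∈ S`,
there is a point `φ ∈ h_{A_n}(S)` with `φ(t) = s` if and only if `s^{n+1} = 0` (and it is then unique,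
`point_eq_of_apply_t_eq`). [cite: Schroeer2003T1LiftingPositiveCharacteristic, Ex. 3.5] -/
theorem exists_point_iff {n : ℕ} {S : Type u} [CommRing S] [Algebra k S] (s : S) :
    (∃ φ : A k n →ₐ[k] S, φ (t k n) = s) ↔ s ^ (n + 1) = 0 := by
  constructor
  · rintro ⟨φ, rfl⟩
    exact apply_t_pow_succ φ
  · intro hs
    exact ⟨AdjoinRoot.liftAlgHom _ (Algebra.ofId k S) s (by rwa [eval₂_X_pow]), AdjoinRoot.liftAlgHom_root _ _ _ _⟩

/-! ### §2 «Clearly, `R` is not a smooth formal algebra»: `h_{A_n}(A_{n+1}) → h_{A_n}(A_n)` is not onto (`n ≥ 1`, any `k`) -/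

/-- **«`R` is not smooth»**, in every characteristic: for `n ≥ 1` the map `h_{A_n}(A_{n+1}) → h_{A_n}(A_n)` induced by
`i : A_{n+1} → A_n` is NOT surjective — the identity point `t ↦ t` does not lift: a lift sends `t` to some
`v = t + c·t^{n+1} ∈ A_{n+1}` (the fibre of `i` over `t`, `T1Lifting.exists_eq_smul_of_i_eq_zero`), and
`v^{n+1} = t^{n+1} + (n+1)·tⁿ·(c t^{n+1}) = t^{n+1} ≠ 0` in `A_{n+1}` since `t^{2n+1} = 0` there (`n ≥ 1`). So along the
small extension `A_{n+1} → A_n` (`T1Lifting.isSmallExtension_i`) the functor `h_{A_n}` is not smooth.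
[cite: Schroeer2003T1LiftingPositiveCharacteristic, Ex. 3.5] -/
theorem points_map_i_not_surjective (n : ℕ) (hn : 1 ≤ n) :
    ¬ Function.Surjective
      ((ArtinFunctor.points (k := k) (A k n)).map (R := artA k (n + 1)) (S := artA k n) (i k n)) := by
  intro hsurj
  obtain ⟨φ, hφ⟩ := hsurj (AlgHom.id k (A k n))
  -- `φ : A_n → A_{n+1}` with `i ∘ φ = id`; put `v = φ(t)`
  change A k n →ₐ[k] A k (n + 1) at φ
  change (i k n).comp φ = AlgHom.id k (A k n) at hφ
  have hiv : i k n (φ (t k n)) = t k n := AlgHom.congr_fun hφ (t k n)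
  obtain ⟨c, hc⟩ := exists_eq_smul_of_i_eq_zero k n (e := φ (t k n) - t k (n + 1))
    (by rw [map_sub, hiv, i_t, sub_self])
  have hv : φ (t k n) = t k (n + 1) + c • t k (n + 1) ^ (n + 1) := by rw [← hc, add_sub_cancel]
  -- `y = c t^{n+1}` squares to zero in `A_{n+1}` (`2n + 2 ≥ n + 2`)
  have hy : (c • t k (n + 1) ^ (n + 1)) * (c • t k (n + 1) ^ (n + 1)) = 0 := by
    rw [smul_mul_smul_comm, ← pow_add, t_pow_eq_zero_of_lt k (by omega), smul_zero]
  have hpow := apply_t_pow_succ φ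
  rw [hv, add_pow_succ_of_mul_self_eq_zero _ _ hy, mul_smul_comm, mul_assoc, ← pow_add,
    t_pow_eq_zero_of_lt k (show n + 1 < n + (n + 1) by omega), mul_zero, smul_zero, add_zero] at hpow
  exact t_pow_ne_zero k (n + 1) hpow

/-! ### §3 «It satisfies the `T¹`-lifting condition»: when `n + 1 = 0` in `k` -/

/-- **«It satisfies the `T¹`-lifting condition in Kawamata's sense»** ([Schroeer2003T1LiftingPositiveCharacteristic, Ex. 3.5]),
in the form of [FantechiManetti1999T1Lifting, Def. 1.1] (`F(B_{N+1}) → F(B_N) ×_{F(A_N)} F(A_{N+1})` onto for every `N`,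
which contains Kawamata's per-`X_{N+1}` surjectivity `T¹(X_{N+1}/A_{N+1}) → T¹(X_N/A_N)`): if `n + 1 = 0` in `k`, the
functor `h_{A_n}` = «`A ↦ {a ∈ A | a^{n+1} = 0}`» HAS the T¹-lifting property. Given `u ∈ B_N` and `v ∈ A_{N+1}` with
`u^{n+1} = 0`, `v^{n+1} = 0`, `u_x = v mod t^{N+1}`, the element `w = v + s·y ∈ B_{N+1}` (`s` any lift of `u_y`) lies over
both and `w^{n+1} = v^{n+1} + (n+1)·vⁿ·s·y = 0` — the binomial coefficient of print's diagnosis vanishes.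
[cite: Schroeer2003T1LiftingPositiveCharacteristic, Ex. 3.5 and Introduction] [cite: FantechiManetti1999T1Lifting, Def. 1.1] -/
theorem t1Lifting_points (n : ℕ) (hn : (n : k) + 1 = 0) : (ArtinFunctor.points (k := k) (A k n)).T1Lifting := by
  intro N b a hab
  -- `u = b(t) ∈ B_N`, `v = a(t) ∈ A_{N+1}`, `u.fst = i v`
  change A k n →ₐ[k] B k N at b
  change A k n →ₐ[k] A k (N + 1) at a
  change (bA k N).comp b = (i k N).comp a at hab
  have huv : (b (t k n)).fst = i k N (a (t k n)) := by
    have := AlgHom.congr_fun hab (t k n)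
    simpa using this
  obtain ⟨s, hs⟩ := i_surjective k N (b (t k n)).snd
  -- the lift `w = inl v + inr s ∈ B_{N+1}`
  set w : B k (N + 1) := inl (a (t k n)) + inr s with hw
  have hyy : (inr s : B k (N + 1)) * inr s = 0 := inr_mul_inr _ _ _
  have hn' : ((n : B k (N + 1)) + 1) = 0 := by
    have h := congrArg (algebraMap k (B k (N + 1))) hn
    rwa [map_add, map_natCast, map_one, map_zero] at h
  have hwpow : w ^ (n + 1) = 0 := by
    rw [hw, add_pow_succ_of_mul_self_eq_zero _ _ hyy, inl_pow, apply_t_pow_succ, inl_zero, zero_add, hn', zero_mul,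
      zero_mul]
  obtain ⟨b', hb'⟩ := (exists_point_iff (k := k) (n := n) w).2 hwpow
  refine ⟨b', ?_, ?_⟩
  · -- `β ∘ b' = b`: both send `t` to `u`
    change (β k N).comp b' = b
    apply point_eq_of_apply_t_eq
    change β k N (b' (t k n)) = b (t k n)
    rw [hb', hw]
    refine TrivSqZeroExt.ext ?_ ?_
    · rw [fst_β, fst_add, fst_inl, fst_inr, add_zero, huv]
    · rw [snd_β, snd_add, snd_inl, snd_inr, zero_add, hs]
  · -- `bA ∘ b' = a`: both send `t` to `v`
    change (bA k (N + 1)).comp b' = a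
    apply point_eq_of_apply_t_eq
    change bA k (N + 1) (b' (t k n)) = a (t k n)
    rw [hb', hw, bA_apply, fst_add, fst_inl, fst_inr, add_zero]

/-! ### §4 The printed sentence: T¹-lifting without smoothness in characteristic `p` -/

/-- **DELIGNE'S EXAMPLE — THE T¹-LIFTING THEOREM NEEDS CHARACTERISTIC ZERO**
([Schroeer2003T1LiftingPositiveCharacteristic, Ex. 3.5]: the functor «`A ↦ {a ∈ A | a^p = 0}` represented by
`k[T]/(T^p)`» «satisfies the `T¹`-lifting condition in Kawamata's sense without being smooth»; Introduction: «The proofs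
for these results work in characteristic zero only … he needs invertibility of the binomial coefficient»). For a field
`k` of characteristic `p > 0`, the functor of points `F = h_{A_{p−1}}`, `A_{p−1} = k[t]/(t^p)`, satisfies (H₄) AND the
T¹-lifting property of [FantechiManetti1999T1Lifting, Def. 1.1], yet `F(A_p) → F(A_{p−1})` is not surjective — the
conclusion «`F(A_{m+2}) → F(A_{m+1})` onto for every `m`» of the tree's characteristic-zero T¹-lifting theorem
`ArtinFunctor.map_i_succ_surjective_of_t1Lifting` fails at `m = p − 2`; its hypothesis `CharZero k` (print's «in
characteristic zero», [FantechiManetti1999T1Lifting, p. 3]) cannot be dropped.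
[cite: Schroeer2003T1LiftingPositiveCharacteristic, Ex. 3.5 and Introduction] [cite: FantechiManetti1999T1Lifting, Def. 1.1 and p. 3] -/
theorem t1Lifting_theorem_fails_of_charP (p : ℕ) [hp : Fact p.Prime] [CharP k p] :
    ∃ F : ArtinFunctor.{u} k, F.H4 ∧ F.T1Lifting ∧
      ∃ m : ℕ, ¬ Function.Surjective (F.map (R := artA k (m + 2)) (S := artA k (m + 1)) (i k (m + 1))) := by
  obtain ⟨m, hm⟩ : ∃ m : ℕ, p = m + 2 := ⟨p - 2, by have := hp.out.two_le; omega⟩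
  refine ⟨ArtinFunctor.points (k := k) (A k (m + 1)), ArtinFunctor.points_H4 _, t1Lifting_points (m + 1) ?_,
    m, points_map_i_not_surjective (m + 1) (by omega)⟩
  have h : ((p : ℕ) : k) = 0 := CharP.cast_eq_zero k p
  rw [hm] at h
  push_cast at h ⊢
  linear_combination h

/-- The same with the level made explicit: in characteristic `p`, for `F = h_{k[t]/(t^p)}`, T¹-lifting holds and
`F(A_p) → F(A_{p−1})` (along `i : A_{(p−1)+1} → A_{p−1}`) is not onto.
[cite: Schroeer2003T1LiftingPositiveCharacteristic, Ex. 3.5] -/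
theorem t1Lifting_and_not_surjective_of_charP (p : ℕ) [hp : Fact p.Prime] [CharP k p] :
    (ArtinFunctor.points (k := k) (A k (p - 1))).T1Lifting ∧
      ¬ Function.Surjective ((ArtinFunctor.points (k := k) (A k (p - 1))).map (R := artA k (p - 1 + 1))
        (S := artA k (p - 1)) (i k (p - 1))) := by
  have h2 := hp.out.two_le
  refine ⟨t1Lifting_points (p - 1) ?_, points_map_i_not_surjective (p - 1) (by omega)⟩
  have h : ((p : ℕ) : k) = 0 := CharP.cast_eq_zero k p
  have hp1 : p = (p - 1) + 1 := by omega
  rw [hp1] at h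
  push_cast at h ⊢
  exact h

/-! ### §5 Conversely: if `n + 1 ≠ 0` in `k` then `h_{A_n}` does NOT have the T¹-lifting property (`n ≥ 1`) -/

/-- The test pair of §5: at level `N = m` the points `b = (t ↦ x + y) ∈ h_{A_{m+1}}(B_m)` (print's «`(T+ε)`»; it is
the tree's `fB_m : A_{m+1} → B_m`, a point since `(x + y)^{m+2} = 0` in `B_m`) and `a = id ∈ h_{A_{m+1}}(A_{m+1})` are
compatible: both give `t ↦ t` in `h_{A_{m+1}}(A_m)`. [cite: Schroeer2003T1LiftingPositiveCharacteristic, Introduction (arXiv p0003 L19–23)]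
[cite: FantechiManetti1999T1Lifting, Def. 1.1 and p. 3] -/
theorem bA_comp_fB_eq_i_comp_id (m : ℕ) :
    (bA k m).comp (fB k m) = (i k m).comp (AlgHom.id k (A k (m + 1))) := by
  apply point_eq_of_apply_t_eq
  rw [AlgHom.comp_apply, AlgHom.comp_apply, fB_t, bA_apply, fst_xy, AlgHom.id_apply, i_t]

/-- The binomial coefficient in `B_{m+1} = A_{m+1}[ε]`: for every `s ∈ A_{m+1}`,
`(x + s·y)^{m+2} = (m + 2)·x^{m+1}·s·y` (`x = t`, `y = ε`, `x^{m+2} = 0`, `y² = 0`).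
[cite: Schroeer2003T1LiftingPositiveCharacteristic, Introduction (arXiv p0003 L19–23)] -/
theorem inl_t_add_inr_pow (m : ℕ) (s : A k (m + 1)) :
    (inl (t k (m + 1)) + inr s : B k (m + 1)) ^ (m + 1 + 1) =
      inr (((m : A k (m + 1)) + 2) * t k (m + 1) ^ (m + 1) * s) := by
  rw [add_pow_succ_of_mul_self_eq_zero _ _ (inr_mul_inr _ _ _), inl_pow, t_pow_succ, inl_zero, zero_add, inl_pow]
  have hc : (((m + 1 : ℕ) : B k (m + 1)) + 1) = inl (((m : A k (m + 1)) + 2)) := by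
    refine TrivSqZeroExt.ext ?_ ?_
    · rw [fst_add, fst_natCast, fst_one, fst_inl]; push_cast; ring
    · rw [snd_add, snd_natCast, snd_one, snd_inl, add_zero]
  rw [hc, inl_mul_inl, inl_mul_inr, smul_eq_mul]

/-- **If `n + 1` is NOT zero in `k`, the functor «`A ↦ {a ∈ A | a^{n+1} = 0}`» `= h_{A_n}` FAILS the T¹-lifting
property** (`n = m + 1 ≥ 1`): the compatible pair (`x + y ∈ h_{A_{m+1}}(B_m)`, `id ∈ h_{A_{m+1}}(A_{m+1})`) of
`bA_comp_fB_eq_i_comp_id` has no common lift to `h_{A_{m+1}}(B_{m+1})` — a lift is `t ↦ x + s·y` with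
`s ≡ 1 (mod t^{m+1})`, and `(x + s y)^{m+2} = (m+2)·x^{m+1}·y ≠ 0` unless `m + 2 = 0` in `k`. This is the converse of
`t1Lifting_points`: print's binomial coefficient `\binom{n}{1}` is the whole obstruction. (A kernel sharpening of
[Schroeer2003T1LiftingPositiveCharacteristic, Introduction]'s diagnosis; in characteristic `0` it also follows from the
T¹-lifting theorem and §2, see `not_t1Lifting_points_of_charZero'`.)
[cite: Schroeer2003T1LiftingPositiveCharacteristic, Introduction (arXiv p0003 L19–23) and Ex. 3.5] [cite: FantechiManetti1999T1Lifting, Def. 1.1] -/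
theorem not_t1Lifting_points (m : ℕ) (hm : (m : k) + 2 ≠ 0) :
    ¬ (ArtinFunctor.points (k := k) (A k (m + 1))).T1Lifting := by
  intro hT
  obtain ⟨b', hb'1, hb'2⟩ := hT m (fB k m) (AlgHom.id k (A k (m + 1))) (bA_comp_fB_eq_i_comp_id m)
  change A k (m + 1) →ₐ[k] B k (m + 1) at b'
  change (β k m).comp b' = fB k m at hb'1
  change (bA k (m + 1)).comp b' = AlgHom.id k (A k (m + 1)) at hb'2
  -- `w = b'(t) = x + s y` with `i(s) = 1`
  have hfst : (b' (t k (m + 1))).fst = t k (m + 1) := by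
    have h := AlgHom.congr_fun hb'2 (t k (m + 1))
    rwa [AlgHom.comp_apply, bA_apply, AlgHom.id_apply] at h
  have hsnd : i k m (b' (t k (m + 1))).snd = 1 := by
    have h := congrArg TrivSqZeroExt.snd (AlgHom.congr_fun hb'1 (t k (m + 1)))
    rwa [AlgHom.comp_apply, snd_β, fB_t, snd_xy] at h
  obtain ⟨c, hc⟩ := exists_eq_smul_of_i_eq_zero k m (e := (b' (t k (m + 1))).snd - 1)
    (by rw [map_sub, hsnd, map_one, sub_self])
  have hs : (b' (t k (m + 1))).snd = 1 + c • t k (m + 1) ^ (m + 1) := by rw [← hc, add_sub_cancel]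
  have hw : b' (t k (m + 1)) = inl (t k (m + 1)) + inr (1 + c • t k (m + 1) ^ (m + 1)) :=
    TrivSqZeroExt.ext (by rw [hfst, fst_add, fst_inl, fst_inr, add_zero])
      (by rw [hs, snd_add, snd_inl, snd_inr, zero_add])
  -- `w^{m+2} = 0` (a point of `A_{m+1} = k[t]/(t^{m+2})`), but it is `(m+2)·x^{m+1}·y`
  have hpow := apply_t_pow_succ b'
  rw [hw, inl_t_add_inr_pow, mul_add, mul_one, mul_smul_comm, mul_assoc, ← pow_add,
    t_pow_eq_zero_of_lt k (show m + 1 < m + 1 + (m + 1) by omega), mul_zero, smul_zero, add_zero] at hpow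
  have h0 : ((m : A k (m + 1)) + 2) * t k (m + 1) ^ (m + 1) = 0 := inr_injective (by rw [hpow, inr_zero])
  have h1 : ((m : A k (m + 1)) + 2) = algebraMap k (A k (m + 1)) ((m : k) + 2) := by
    rw [map_add, map_natCast, map_ofNat]
  rw [h1, ← Algebra.smul_def, smul_eq_zero] at h0
  exact h0.elim hm (t_pow_ne_zero k (m + 1))

/-- At `n = 0` (`A_0 = k`, the functor «`a^1 = 0`», a single point everywhere) the T¹-lifting property holds
trivially. [cite: FantechiManetti1999T1Lifting, Def. 1.1] -/
theorem t1Lifting_points_zero : (ArtinFunctor.points (k := k) (A k 0)).T1Lifting := by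
  intro N b a _
  change A k 0 →ₐ[k] B k N at b
  change A k 0 →ₐ[k] A k (N + 1) at a
  have hb : b (t k 0) = 0 := by simpa using apply_t_pow_succ b
  have ha : a (t k 0) = 0 := by simpa using apply_t_pow_succ a
  obtain ⟨b', hb'⟩ := (exists_point_iff (k := k) (n := 0) (0 : B k (N + 1))).2 (by simp)
  refine ⟨b', ?_, ?_⟩
  · change (β k N).comp b' = b
    apply point_eq_of_apply_t_eq
    rw [AlgHom.comp_apply, hb', map_zero, hb]
  · change (bA k (N + 1)).comp b' = a
    apply point_eq_of_apply_t_eq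
    rw [AlgHom.comp_apply, hb', map_zero, ha]

/-- **THE BINOMIAL COEFFICIENT IS THE WHOLE STORY** (kernel sharpening of
[Schroeer2003T1LiftingPositiveCharacteristic, Introduction and Ex. 3.5]): for a field `k` of ANY characteristic and
`n ∈ ℕ`, the functor «`A ↦ {a ∈ A | a^{n+1} = 0}`» `= h_{k[t]/(t^{n+1})}` has the T¹-lifting property of
[FantechiManetti1999T1Lifting, Def. 1.1] if and only if `n = 0` or `n + 1 = 0` in `k` — i.e. iff `n = 0` or
`char k` divides `n + 1`. [cite: Schroeer2003T1LiftingPositiveCharacteristic, Introduction (arXiv p0003 L19–23) and Ex. 3.5]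
[cite: FantechiManetti1999T1Lifting, Def. 1.1] -/
theorem t1Lifting_points_iff (n : ℕ) :
    (ArtinFunctor.points (k := k) (A k n)).T1Lifting ↔ n = 0 ∨ (n : k) + 1 = 0 := by
  constructor
  · intro hT
    rcases n with _ | m
    · exact Or.inl rfl
    · right
      by_contra hne
      refine not_t1Lifting_points m ?_ hT
      push_cast at hne
      rwa [add_assoc, one_add_one_eq_two] at hne
  · rintro (rfl | hn)
    · exact t1Lifting_points_zero
    · exact t1Lifting_points n hn

/-- In characteristic ZERO Deligne's functor never has the T¹-lifting property (`n ≥ 1`) — directly from §5.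
[cite: Schroeer2003T1LiftingPositiveCharacteristic, Introduction] -/
theorem not_t1Lifting_points_of_charZero [CharZero k] (n : ℕ) (hn : 1 ≤ n) :
    ¬ (ArtinFunctor.points (k := k) (A k n)).T1Lifting := by
  rw [t1Lifting_points_iff]
  rintro (rfl | h)
  · omega
  · have h' : ((n + 1 : ℕ) : k) ≠ 0 := Nat.cast_ne_zero.2 (Nat.succ_ne_zero n)
    push_cast at h'
    exact h' h

/-- … and, independently of §5, from the characteristic-zero T¹-LIFTING THEOREM itself (the tree's
`ArtinFunctor.map_i_succ_surjective_of_t1Lifting`, [FantechiManetti1999T1Lifting, Thm. A′]) together with §2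
(«`R` is not smooth»): T¹-lifting would make `h_{A_n}(A_{n+1}) → h_{A_n}(A_n)` onto. So Deligne's example is a
phenomenon of positive characteristic only, as print says.
[cite: Schroeer2003T1LiftingPositiveCharacteristic, Introduction and Ex. 3.5] [cite: FantechiManetti1999T1Lifting, Thm. A] -/
theorem not_t1Lifting_points_of_charZero' [CharZero k] (n : ℕ) (hn : 1 ≤ n) :
    ¬ (ArtinFunctor.points (k := k) (A k n)).T1Lifting := by
  intro hT
  obtain ⟨m, rfl⟩ : ∃ m, n = m + 1 := ⟨n - 1, by omega⟩
  exact points_map_i_not_surjective (m + 1) hn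
    (ArtinFunctor.map_i_succ_surjective_of_t1Lifting _ (ArtinFunctor.points_H4 _) hT m)

/-! ### §6 «`Ω¹_{R/W} ⊗ k` is a free `R ⊗ k`-module of rank one, generated by `dT`» -/

/-- `Ω_{A_n/k}` is generated by `dT`: `d(q(t)) = q′(t)·dt` for every polynomial `q`.
[cite: Schroeer2003T1LiftingPositiveCharacteristic, Ex. 3.5] -/
theorem kaehlerDifferential_D_mk (n : ℕ) (q : k[X]) :
    KaehlerDifferential.D k (A k n) (AdjoinRoot.mk ((X : k[X]) ^ (n + 1)) q) =
      (AdjoinRoot.mk ((X : k[X]) ^ (n + 1)) (derivative q) : A k n) •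
        KaehlerDifferential.D k (A k n) (t k n) := by
  rw [← AdjoinRoot.aeval_eq, ← AdjoinRoot.aeval_eq, Derivation.map_aeval]

/-- `Ω_{A_n/k}` is generated by `dT`: every Kähler differential of `A_n = k[t]/(t^{n+1})` over `k` is a multiple
`s·dt`. [cite: Schroeer2003T1LiftingPositiveCharacteristic, Ex. 3.5] -/
theorem exists_eq_smul_D_t (n : ℕ) (ω : Ω[A k n⁄k]) :
    ∃ s : A k n, ω = s • KaehlerDifferential.D k (A k n) (t k n) := by
  have hmem : ω ∈ Submodule.span (A k n) (Set.range (KaehlerDifferential.D k (A k n))) := by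
    rw [KaehlerDifferential.span_range_derivation]; trivial
  refine Submodule.span_induction ?_ ⟨0, by rw [zero_smul]⟩ ?_ ?_ hmem
  · rintro _ ⟨x, rfl⟩
    induction x using AdjoinRoot.induction_on with
    | ih q => exact ⟨_, kaehlerDifferential_D_mk n q⟩
  · rintro _ _ _ _ ⟨s₁, rfl⟩ ⟨s₂, rfl⟩
    exact ⟨s₁ + s₂, by rw [add_smul]⟩
  · rintro a _ _ ⟨s, rfl⟩
    exact ⟨a * s, by rw [mul_smul]⟩

/-- `d(t^{n+1}) = (n+1)·tⁿ·dt = 0` in `Ω_{A_n/k}`: the relation carried by `dT`.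
[cite: Schroeer2003T1LiftingPositiveCharacteristic, Introduction and Ex. 3.5] -/
theorem natCast_succ_smul_t_pow_smul_D_t (n : ℕ) :
    ((n : k) + 1) • (t k n ^ n • KaehlerDifferential.D k (A k n) (t k n)) = 0 := by
  have h := (KaehlerDifferential.D k (A k n)).leibniz_pow (t k n) (n + 1)
  rw [t_pow_succ, map_zero, Nat.add_sub_cancel] at h
  rw [show ((n : k) + 1) = ((n + 1 : ℕ) : k) by push_cast; ring, Nat.cast_smul_eq_nsmul]
  exact h.symm

/-- The point `t ↦ x + y` of `h_{A_n}(B_n)`, `B_n = A_n[ε]` — it exists exactly when `(x + y)^{n+1} = (n+1)·xⁿ·y`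
vanishes, i.e. when `n + 1 = 0` in `k` — and the `k`-derivation `∂/∂t : A_n → A_n`, `t ↦ 1`, it defines.
[cite: Schroeer2003T1LiftingPositiveCharacteristic, Introduction and Ex. 3.5] -/
theorem exists_derivation_apply_t_eq_one (n : ℕ) (hn : (n : k) + 1 = 0) :
    ∃ d : Derivation k (A k n) (A k n), d (t k n) = 1 := by
  have hxy : (xy k n) ^ (n + 1) = 0 := by
    rw [xy_pow_succ]; push_cast; rw [hn, zero_smul]
  obtain ⟨φ, hφ⟩ := (exists_point_iff (k := k) (n := n) (xy k n)).2 hxy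
  have hfst : ∀ x, (φ x).fst = x := fun x => by
    have h : (bA k n).comp φ = AlgHom.id k (A k n) :=
      point_eq_of_apply_t_eq (by rw [AlgHom.comp_apply, bA_apply, hφ, fst_xy, AlgHom.id_apply])
    exact AlgHom.congr_fun h x
  refine ⟨{ toFun := fun x => (φ x).snd,
             map_add' := fun x y => show (φ (x + y)).snd = (φ x).snd + (φ y).snd by
               rw [map_add, snd_add],
             map_smul' := fun c x => show (φ (c • x)).snd = (RingHom.id k c) • (φ x).snd by
               rw [map_smul, snd_smul, RingHom.id_apply],
             map_one_eq_zero' := show (φ 1).snd = 0 by rw [map_one, snd_one],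
             leibniz' := fun x y => show (φ (x * y)).snd = x • (φ y).snd + y • (φ x).snd by
               rw [map_mul, DualNumber.snd_mul, hfst, hfst, smul_eq_mul, smul_eq_mul, mul_comm (φ x).snd y] },
    ?_⟩
  change (φ (t k n)).snd = 1
  rw [hφ, snd_xy]

/-- **«`Ω¹_{R/W} ⊗ k` is a free `R ⊗ k`-module of rank one, generated by `dT`»**
([Schroeer2003T1LiftingPositiveCharacteristic, Ex. 3.5], `R = W[T]/(T^p)`, `R ⊗_W k = k[T]/(T^p)`), typed for
`k[t]/(t^{n+1})` over `k` whenever `n + 1 = 0` in `k`: `Ω_{A_n/k}` has an `A_n`-basis consisting of `dt` alone.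
(`dt` spans by `exists_eq_smul_D_t`; it is free because `∂/∂t` (`exists_derivation_apply_t_eq_one`) induces an
`A_n`-linear `Ω_{A_n/k} → A_n` with `dt ↦ 1`.) [cite: Schroeer2003T1LiftingPositiveCharacteristic, Ex. 3.5] -/
theorem exists_basis_kaehlerDifferential (n : ℕ) (hn : (n : k) + 1 = 0) :
    ∃ b : Module.Basis (Fin 1) (A k n) (Ω[A k n⁄k]), b 0 = KaehlerDifferential.D k (A k n) (t k n) := by
  obtain ⟨d, hd⟩ := exists_derivation_apply_t_eq_one n hn
  set f : A k n →ₗ[A k n] Ω[A k n⁄k] := LinearMap.toSpanSingleton (A k n) _ (KaehlerDifferential.D k (A k n) (t k n))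
    with hf
  set g : Ω[A k n⁄k] →ₗ[A k n] A k n := d.liftKaehlerDifferential with hg
  have hgf : g.comp f = LinearMap.id := by
    refine LinearMap.ext fun s => ?_
    rw [LinearMap.comp_apply, hf, LinearMap.toSpanSingleton_apply, map_smul, hg,
      Derivation.liftKaehlerDifferential_comp_D, hd, smul_eq_mul, mul_one, LinearMap.id_apply]
  have hfg : f.comp g = LinearMap.id := by
    refine LinearMap.ext_on_range (KaehlerDifferential.span_range_derivation k (A k n)) fun x => ?_
    rw [LinearMap.comp_apply, LinearMap.id_apply]
    induction x using AdjoinRoot.induction_on with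
    | ih q =>
      rw [kaehlerDifferential_D_mk, map_smul, map_smul, hg, Derivation.liftKaehlerDifferential_comp_D, hd, hf,
        LinearMap.toSpanSingleton_apply, one_smul]
  let e : A k n ≃ₗ[A k n] Ω[A k n⁄k] := LinearEquiv.ofLinear f g hfg hgf
  refine ⟨(Module.Basis.singleton (Fin 1) (A k n)).map e, ?_⟩
  rw [Module.Basis.map_apply, Module.Basis.singleton_apply]
  show f 1 = _
  rw [hf, LinearMap.toSpanSingleton_apply, one_smul]

/-- In particular (`n + 1 = 0` in `k`) `Ω_{A_n/k}` is free of rank one.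
[cite: Schroeer2003T1LiftingPositiveCharacteristic, Ex. 3.5] -/
theorem free_and_finrank_kaehlerDifferential_eq_one (n : ℕ) (hn : (n : k) + 1 = 0) :
    Module.Free (A k n) (Ω[A k n⁄k]) ∧ Module.finrank (A k n) (Ω[A k n⁄k]) = 1 := by
  obtain ⟨b, _⟩ := exists_basis_kaehlerDifferential n hn
  exact ⟨Module.Free.of_basis b, by rw [Module.finrank_eq_card_basis b, Fintype.card_fin]⟩

/-- Contrast (`n + 1` NOT zero in `k`, e.g. characteristic `0`): then `tⁿ·dt = 0` with `tⁿ ≠ 0`, so `dt` is a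
torsion element (for `n = 0` simply `dt = 0`) and `Ω_{A_n/k}` — still generated by `dt` — is NOT free on `dt`: the
freeness in print's sentence is special to `p ∣ n + 1`. [cite: Schroeer2003T1LiftingPositiveCharacteristic, Introduction and Ex. 3.5] -/
theorem not_exists_basis_kaehlerDifferential (n : ℕ) (hn : (n : k) + 1 ≠ 0) :
    ¬ ∃ b : Module.Basis (Fin 1) (A k n) (Ω[A k n⁄k]), b 0 = KaehlerDifferential.D k (A k n) (t k n) := by
  rintro ⟨b, hb⟩
  have htor : t k n ^ n • KaehlerDifferential.D k (A k n) (t k n) = 0 := by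
    have h := natCast_succ_smul_t_pow_smul_D_t (k := k) n
    rwa [smul_eq_zero, or_iff_right hn] at h
  have hrepr := congrArg (fun ω => b.repr ω 0) htor
  simp only [map_smul, map_zero, Finsupp.smul_apply, Finsupp.coe_zero, Pi.zero_apply, ← hb, Module.Basis.repr_self,
    Finsupp.single_eq_same, smul_eq_mul, mul_one] at hrepr
  exact t_pow_ne_zero k n hrepr

/-- **DELIGNE'S EXAMPLE IN CHARACTERISTIC `p`, BOTH PRINTED SENTENCES**: for `char k = p > 0` and
`R ⊗ k = k[T]/(T^p) = A_{p−1}`: «`Ω¹ … is a free module of rank one, generated by `dT`» AND the functor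
`A ↦ {a | a^p = 0}` «satisfies the `T¹`-lifting condition … without being smooth».
[cite: Schroeer2003T1LiftingPositiveCharacteristic, Ex. 3.5] -/
theorem charP_summary (p : ℕ) [hp : Fact p.Prime] [CharP k p] :
    (∃ b : Module.Basis (Fin 1) (A k (p - 1)) (Ω[A k (p - 1)⁄k]), b 0 = KaehlerDifferential.D k (A k (p - 1)) (t k (p - 1))) ∧
    (ArtinFunctor.points (k := k) (A k (p - 1))).T1Lifting ∧
      ¬ Function.Surjective ((ArtinFunctor.points (k := k) (A k (p - 1))).map (R := artA k (p - 1 + 1))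
        (S := artA k (p - 1)) (i k (p - 1))) := by
  have h2 := hp.out.two_le
  have h : ((p - 1 : ℕ) : k) + 1 = 0 := by
    have h0 : ((p : ℕ) : k) = 0 := CharP.cast_eq_zero k p
    have hp1 : p = (p - 1) + 1 := by omega
    rw [hp1] at h0
    push_cast at h0 ⊢
    exact h0
  exact ⟨exists_basis_kaehlerDifferential (p - 1) h, t1Lifting_points (p - 1) h,
    points_map_i_not_surjective (p - 1) (by omega)⟩

end DeligneExample

end Literature.AlgebraicGeometry.Deformation
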